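import Literature.MathematicalPhysics.QuantumFieldTheory.Balaban1983to89.B8Prop6CubeMember

/-!
# `Balaban1983to89.B8Ineq133CubeMemberGamma` — [Balaban1985RegularSpaces] (1.133) p. 99 FOR THE PAIR `(1, U₀″)` AT THE CUBE MEMBER,
# READ IN PRINT's GUARD «the box of a level-`j` bond lies in Ω_{j−1}» (EDITION γ of `B8Prop6CubeMember.thm4_hypotheses_one_cutFixed`)

statement-level skeleton of published theorems with citation tags; proofs where landed; nothing here is a claim about the
Yang–Mills mass gap

PDF held: `paper:balaban1985-cmp99-regular-spaces-gauge-fixing` (journal page = PDF page + 74); (1.133) p. 99 «|Ū₀″ʲ − 1| < 6dL²Mα₀ on □_j^{(j)},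
j = 0, 1, …, k, by the construction of U₀″, and the inequality (1.130)», p. 99 «equal to U₀′ on □̃, and equal to 1 outside □̃», (1.130) p. 98,
(1.35) p. 82, p. 77 «Ω also denotes the set of bonds … at least one end-point of b belongs to Ω», (1.31) p. 82 — re-read this session on the text layer.

CITATION HEADER (lean-in-tree rule).  Cell `pub-ymgap` (HUMAN RULING D-0062, Track A), DAG node N05 = [B8], seat `pub-ymgap-dag-n05-c` g12;
dag-n05-e g9's LOCATED-AVG135 (b) (cell bus 2026-08-27T22:46:10Z): «the cube road's Prop-6 datum needs (1.133) at the level-j crossing bonds of {□_j}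
(both ends in □_{j−1}^{(j)}, one in □_j^{(j)}) — r05's `ineq132_cubes` + n05-c's datum lemma in that guard … owners to confirm».  WHY THIS FILE.
`B8Prop6CubeMember.thm4_hypotheses_one_cutFixed` (this seat, g0) states the p. 99 sentence «the assumptions of Theorem 4 are satisfied for the pair of
configurations 1, U₀″» in the currency of dag-n05-a's driver, whose (1.35)∕(1.66) conjunct is guarded by «the fine box of the level-`j` bond lies in
□_j» — the reading of `B8Eq131Cubes.ineq132_cubes`, which RESTRICTS `B8Ineq133.ineq133` (v) to `□_j^{(j)}` (`sq_le_tilde`).  After the shell-mode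
certificate (`B8Ineq159FlatShellModeVacuity`, p572834) Theorem 4's driver was re-pointed to print's box law (dag-n05-e `B8Eq142KLevelLocalGamma.H42_of_inAx_γ`,
`B8Thm4KLevelGamma`): its datum hypothesis `h135` reads (1.35) on every level-`j` bond whose box lies in `Ω_{j−1}` (ℕ subtraction; print p. 77:
the bonds OF `Ω_j` include the level-`j` crossing bonds of (1.31)).  THIS FILE serves that guard for the pair `(1, U₀″)` from the LANDED (1.133):
`B8Ineq133.ineq133` (v) bounds `|Ū₀″ʲ(x, x + e_ν) − 1|` for EVERY coarse bond with both ends in `□̃^{(j)}` (the tower over `□̃`, where `U₀″ = U₀′` is the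
axial-gauged configuration of p. 98), and a level-`j` bond whose fine box lies in `□_{j−1} ⊂ □̃` (`B8Eq131Cubes.cube_subset_tcube`) has its two
corners `Lʲ•z`, `Lʲ•(z + e_μ)` in `□̃`, i.e. both coarse ends in `□̃^{(j)}` (`B8Eq131CubesAdmissible.inBox_tower_smul_iff`).  So print's guard — indeed the
weaker guard «box ⊂ □̃» — costs no new estimate.  Kind «kernel-checked proof»; six theorems, no `def`.

WHAT THIS FILE PROVES.  §1 geometry: `ends_inBox_tilde_of_bondBox_subset_tcube` (box ⊂ □̃ ⇒ both coarse ends in □̃^{(j)}),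
`bondBox_subset_tcube_of_subset_cubeFam` (box ⊂ □_{j′}, `j′ ≤ k` ⇒ box ⊂ □̃).  §2 (general `AvgClosed` value group `G`, as `B8Ineq133`):
★ `norm_avgIter_cutFixed_sub_one_lt_of_tcube` — (1.133) `‖Ū₀″ʲ(z, z + e_ν) − 1‖ < 6dL²Mα₀` at every level-`j` bond (`j ≤ k`) whose box lies in `□̃`;
★ `h135_cutFixed_tcube` ∕ ★ `h135_cutFixed_γ` — the driver's clause `‖(U₀″·1)‾ʲ(z, μ) − 1̄ʲ(z, μ)‖ ≤ 6dL²Mα₀` under «box ⊂ □̃» ∕ «box ⊂ cubeFam false … (j − 1)»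
(= `H42_of_inAx_γ`'s `h135` with `Ω := cubeFam false L a M ρ k`, `U₀ := 1`, `U′ := U₀″`, `α₁ := 6dL²Mα₀`).  §3 (unitary values, `CStarAlgebra`):
★★ `thm4_hypotheses_one_cutFixed_γ` — the six conjuncts of `B8Prop6CubeMember.thm4_hypotheses_one_cutFixed` with conjunct 5 in the γ guard, SAME binders.

HONEST SCOPE.  A guard-widening of a landed datum lemma, derived from the landed (1.133) on `□̃`; no new estimate, no constant changes; the other five
conjuncts are `thm4_hypotheses_one_cutFixed`'s verbatim.  Nothing of Theorem 4 ∕ Proposition 6 is asserted; no socket is stated.  `T_η ↦ ℤᵈ`; `≤` where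
the driver has `≤` ((1.133) itself is kept strict in §2).  Count-neutral; N05 NOT discharged; one finite `𝕋⁴` programme at fixed `ε`, Bałaban as printed;
nothing continuum ∕ ℝ⁴ ∕ OS ∕ mass-gap ∕ Clay.  No `sorry`, no `def`, no `instance`, no `notation`.  Unit `pub-ymgap-dag-n05-c` (g12), 2026-08-27.

RELATED IN THE TREE, NOT DUPLICATED: `B8Ineq133.ineq133` (r05; (1.133) on the whole tower — USED), `B8Eq131Cubes.ineq132_cubes` (r05; the `□_j^{(j)}`
restriction), `B8Prop6CubeMember.norm_cutFixed_sub_one_le` (this seat; the level-0 reading on every fine bond) ∕ `thm4_hypotheses_one_cutFixed` (the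
«box ⊂ □_j» edition — USED for conjuncts 1–4, 6), `B8CubeMemberZd.h135_of_cond166_one` ∕ `ends_inBox_sq_of_bondBox_subset` (the «box ⊂ □_j» plumbing this
file mirrors on `□̃`), `B8Eq142KLevelLocalGamma.H42_of_inAx_γ` ∕ `B8Thm4KLevelGamma` (dag-n05-e; the consumers' `h135` shape).
-/

noncomputable section

namespace Literature.MathematicalPhysics.QuantumFieldTheory.Balaban1983to89.B8Ineq133CubeMemberGamma

open B7Prop1Explicit B7Prop2Explicit B7Prop1Local B8Ineq130
open B7Prop2Explicit (C0 c2')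
open B8Ineq132 (InAk avgIter_one pdevOn_lt_of_inAk)
open B8Ineq133 (cutFixed ineq133)
open B8Lemma1NonAbelian (mulCfg)
open B8Eq119TwistedAxial (InAx)
open B8Eq140Level (SideTouches)
open B8Eq131Cubes (cube tcube tLo tHi ctr ctr_mem two_crad_le tLo_le_tHi cube_subset_tcube)
open B8Eq131CubesAdmissible (cubeFam cubeFam_false_of_le inBox_tower_smul_iff)
open B8CubeMemberZd (cubeLamS smul_mem_bondBox smul_add_mem_bondBox)
open B8Prop6CubeMember (thm4_hypotheses_one_cutFixed)

-- `Site` alone could resolve to the torus sites of `Setup.lean`; re-export the `ℤ^d` sites of `B7Prop1Explicit`.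
export B7Prop1Explicit (Site)

variable {d : ℕ}

/-! ## §1 Geometry: a level-`j` bond whose fine box lies in `□̃` has both coarse ends in `□̃^{(j)}` -/

section Geometry

/-- **A level-`j` bond whose fine box `Bʲ(z) ∪ Bʲ(z + e_μ)` lies in `□̃` has both ends in `□̃^{(j)}`** — the tower box of `□̃` at depth `k − j`
(`B8Ineq130.tlo`∕`thi`): the corners `Lʲ•z`, `Lʲ•(z + e_μ)` of the box lie in `□̃ = Bʲ(□̃^{(j)})`.  The `□̃`-twin of
`B8CubeMemberZd.ends_inBox_sq_of_bondBox_subset`. [cite: Balaban1985RegularSpaces, p.98 («a cube which we denote by □̃», «□_j is a sum of the big blocks of the lattice T_{L^{−j}}»), (1.133) p.99] -/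
theorem ends_inBox_tilde_of_bondBox_subset_tcube {L : ℕ} (hL : 1 ≤ L) (a : Site d) (M ρ : ℕ) {k j : ℕ} (hj : j ≤ k)
    {z : Site d} {μ : Fin d} (hbox : ∀ x, InBox (loK L j z) (bondHiK L j z μ) x → x ∈ tcube L a M ρ k) :
    tlo L (tLo a ρ) (k - j) ≤ z ∧ z + e μ ≤ thi L (tHi a M ρ) (k - j) := by
  obtain ⟨n, rfl⟩ : ∃ n, k = n + j := ⟨k - j, by omega⟩
  rw [Nat.add_sub_cancel]
  have h1 : InBox (tlo L (tLo a ρ) n) (thi L (tHi a M ρ) n) z :=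
    (inBox_tower_smul_iff hL (tLo a ρ) (tHi a M ρ) n j z).1 (hbox _ (smul_mem_bondBox hL j z μ))
  have h2 : InBox (tlo L (tLo a ρ) n) (thi L (tHi a M ρ) n) (z + e μ) :=
    (inBox_tower_smul_iff hL (tLo a ρ) (tHi a M ρ) n j (z + e μ)).1 (hbox _ (smul_add_mem_bondBox hL j z μ))
  exact ⟨fun i => (h1 i).1, fun i => (h2 i).2⟩

/-- **A box inside some `□_{j′}` (`j′ ≤ k`) lies inside `□̃`** (`B8Eq131Cubes.cube_subset_tcube`; `Ω_{j′} = □_{j′}` in the family `{□_j}`,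
`B8Eq131CubesAdmissible.cubeFam_false_of_le`).  In particular print's guard «box ⊂ Ω_{j−1}» and the driver's old guard «box ⊂ Ω_j» both imply
«box ⊂ □̃». [cite: Balaban1985RegularSpaces, p.98 (display before (1.128): the collar of □₀ in □̃), p.99 («□_k ⊂ Ω_{k−1}, □_j ⊂ Ω_j»)] -/
theorem bondBox_subset_tcube_of_subset_cubeFam {L : ℕ} (hL : 2 ≤ L) (a : Site d) (M : ℕ) {ρ k j j' : ℕ} (hρ : 1 ≤ ρ)
    (hj' : j' ≤ k) {z : Site d} {μ : Fin d}
    (hbox : ∀ x, InBox (loK L j z) (bondHiK L j z μ) x → x ∈ cubeFam false L a M ρ k j') :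
    ∀ x, InBox (loK L j z) (bondHiK L j z μ) x → x ∈ tcube L a M ρ k := by
  intro x hx
  have h := hbox x hx
  rw [cubeFam_false_of_le L a M ρ hj'] at h
  exact cube_subset_tcube hL hρ hj' h

end Geometry

/-! ## §2 (1.133) for `U₀″` at every level-`j` bond whose box lies in `□̃`, and the driver's `h135` clause in print's guard -/

section Analytic

variable {𝔸 : Type*} [NormedRing 𝔸] [NormOneClass 𝔸] [NormedAlgebra ℂ 𝔸] [CompleteSpace 𝔸]

/-- ★ **(1.133) FOR `U₀″` AT EVERY LEVEL-`j` BOND WHOSE BOX LIES IN `□̃`** (`j ≤ k`): `‖Ū₀″ʲ(z, z + e_ν) − 1‖ < 6dL²Mα₀`.  Setting and hypotheses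
= `B8Eq131Cubes.ineq132_cubes` (print's `U₀ ∈ 𝔄_k({Ω_j}, α₀)`, `□̃ ⊂ Ω_{k−1}`, `1 ≤ ρ ≤ M` (`R₁M₁ ↦ ρ`), `11d < M`, the (1.130) smallness);
proof = `B8Ineq133.ineq133` (v) at depth `k − j` («by the construction of U₀″, and the inequality (1.130)» — valid on the whole of `□̃^{(j)}`), the
two coarse ends supplied by §1.  The `□_j^{(j)}`-restricted reading is `ineq132_cubes`' third clause. [cite: Balaban1985RegularSpaces, (1.133) p.99, (1.130) p.98, p.99 («equal to U₀′ on □̃, and equal to 1 outside □̃»)] -/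
theorem norm_avgIter_cutFixed_sub_one_lt_of_tcube (L : ℕ) (hL : 2 ≤ L) (hd : 1 ≤ d) {G : Subgroup 𝔸ˣ} (hG : AvgClosed d L G)
    (k : ℕ) (U : Site d → Fin d → 𝔸ˣ) (hU : ∀ x κ, U x κ ∈ G) {α₀ : ℝ} (hα : 0 < α₀)
    (hα3 : C0 d * (α₀ * (L : ℝ) ^ 2) ≤ 1 / 3) (hα2 : 2 * (α₀ * (L : ℝ) ^ 2) ≤ c2' d L)
    (a : Site d) {M ρ : ℕ} (hρ : 1 ≤ ρ) (hρM : ρ ≤ M) (hM : 11 * (d : ℝ) < M)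
    {η : ℝ} {Ω : ℕ → Set (Site d)} (hA : InAk L k η α₀ Ω U) (hT : tcube L a M ρ k ⊆ Ω (k - 1))
    (hsmall : 11 * (d : ℝ) ^ 2 * (L : ℝ) ^ 2 * α₀ + ((M : ℝ) + 4 * ρ) * d * (L : ℝ) ^ 2 * α₀ ≤ 1 / 6)
    {j : ℕ} (hj : j ≤ k) {z : Site d} {ν : Fin d}
    (hbox : ∀ x, InBox (loK L j z) (bondHiK L j z ν) x → x ∈ tcube L a M ρ k) :
    ‖((avgIter L (cutFixed L (tLo a ρ) (tHi a M ρ) U k (ctr a M)) j z ν : 𝔸ˣ) : 𝔸) - 1‖ <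
      6 * d * (L : ℝ) ^ 2 * M * α₀ := by
  have hL1 : 1 ≤ L := le_trans (by norm_num) hL
  have hM1 : 1 ≤ M := hρ.trans hρM
  obtain ⟨hy, hy', hrad⟩ := ctr_mem (a := a) (ρ := ρ) hM1
  have hRM : (ρ : ℝ) * 1 ≤ (M : ℝ) := by rw [mul_one]; exact_mod_cast hρM
  have hsmall' : 11 * (d : ℝ) ^ 2 * (L : ℝ) ^ 2 * α₀ + ((M : ℝ) + 4 * ρ * 1) * d * (L : ℝ) ^ 2 * α₀ ≤ 1 / 6 := by
    rwa [mul_one]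
  have hΩ : ∃ l, l ≤ k ∧ k ≤ l + 1 ∧ ∀ x, InBox (tlo L (tLo a ρ) k) (thi L (tHi a M ρ) k) x → x ∈ Ω l :=
    ⟨k - 1, Nat.sub_le _ _, by omega, fun x hx => hT hx⟩
  have h17 := pdevOn_lt_of_inAk hL1 hα hA hΩ
  obtain ⟨-, -, -, -, -, h6⟩ := ineq133 L hL hd hG k U hU hα hα3 hα2 (tLo a ρ) (tHi a M ρ) (tLo_le_tHi hM1) h17 hy hy'
    hrad (two_crad_le M ρ) hRM hM hsmall'
  obtain ⟨hlo, hhi⟩ := ends_inBox_tilde_of_bondBox_subset_tcube hL1 a M ρ hj hbox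
  have h := h6 (k - j) (Nat.sub_le _ _) z ν hlo hhi
  rwa [Nat.sub_sub_self hj] at h

omit [NormOneClass 𝔸] [NormedAlgebra ℂ 𝔸] [CompleteSpace 𝔸] in
/-- `U₀″ · 1 = U₀″` for the driver's product configuration `B8Lemma1NonAbelian.mulCfg` (private plumbing). [folklore] -/
private theorem mulCfg_one_right (W : Site d → Fin d → 𝔸ˣ) : mulCfg W (1 : Site d → Fin d → 𝔸ˣ) = W := by
  rw [show mulCfg W (1 : Site d → Fin d → 𝔸ˣ) = W * 1 from rfl, mul_one]

/-- ★ **THE DRIVER's (1.35)∕(1.66) CLAUSE FOR THE PAIR `(1, U₀″)` UNDER THE GUARD «box ⊂ □̃»**: for every `j ≤ k` and every level-`j` bond `⟨z, z + e_μ⟩`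
whose fine box lies in `□̃`, `‖(U₀″·1)‾ʲ(z, μ) − 1̄ʲ(z, μ)‖ ≤ 6dL²Mα₀` (`1̄ʲ = 1`, `B8Ineq132.avgIter_one`).  Hypotheses as
`norm_avgIter_cutFixed_sub_one_lt_of_tcube`. [cite: Balaban1985RegularSpaces, (1.133) p.99, (1.66) p.87, (1.35) p.82, (1.20) p.79] -/
theorem h135_cutFixed_tcube (L : ℕ) (hL : 2 ≤ L) (hd : 1 ≤ d) {G : Subgroup 𝔸ˣ} (hG : AvgClosed d L G)
    (k : ℕ) (U : Site d → Fin d → 𝔸ˣ) (hU : ∀ x κ, U x κ ∈ G) {α₀ : ℝ} (hα : 0 < α₀)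
    (hα3 : C0 d * (α₀ * (L : ℝ) ^ 2) ≤ 1 / 3) (hα2 : 2 * (α₀ * (L : ℝ) ^ 2) ≤ c2' d L)
    (a : Site d) {M ρ : ℕ} (hρ : 1 ≤ ρ) (hρM : ρ ≤ M) (hM : 11 * (d : ℝ) < M)
    {η : ℝ} {Ω : ℕ → Set (Site d)} (hA : InAk L k η α₀ Ω U) (hT : tcube L a M ρ k ⊆ Ω (k - 1))
    (hsmall : 11 * (d : ℝ) ^ 2 * (L : ℝ) ^ 2 * α₀ + ((M : ℝ) + 4 * ρ) * d * (L : ℝ) ^ 2 * α₀ ≤ 1 / 6) :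
    ∀ j, j ≤ k → ∀ (z : Site d) (μ : Fin d),
      (∀ x, InBox (loK L j z) (bondHiK L j z μ) x → x ∈ tcube L a M ρ k) →
        ‖(avgIter L (mulCfg (cutFixed L (tLo a ρ) (tHi a M ρ) U k (ctr a M)) (1 : Site d → Fin d → 𝔸ˣ)) j z μ : 𝔸) -
            (avgIter L (1 : Site d → Fin d → 𝔸ˣ) j z μ : 𝔸)‖ ≤ 6 * d * (L : ℝ) ^ 2 * M * α₀ := by
  intro j hj z μ hbox
  rw [mulCfg_one_right, avgIter_one, Pi.one_apply, Pi.one_apply, Units.val_one]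
  exact (norm_avgIter_cutFixed_sub_one_lt_of_tcube L hL hd hG k U hU hα hα3 hα2 a hρ hρM hM hA hT hsmall hj hbox).le

/-- ★ **THE DRIVER's (1.35)∕(1.66) CLAUSE FOR THE PAIR `(1, U₀″)` IN PRINT's GUARD «box ⊂ Ω_{j−1}»** (`Ω_j = cubeFam false … j = □_j`; ℕ subtraction, so
level `0` reads `□₀`) — EXACTLY the `h135` hypothesis of dag-n05-e's `B8Eq142KLevelLocalGamma.H42_of_inAx_γ` ∕ `B8Thm4KLevelGamma` at `Ω := cubeFam false L a M ρ k`,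
`U₀ := 1`, `U′ := U₀″`, `α₁ := 6dL²Mα₀`: the level-`j` crossing bonds of (1.31) (one end in `□_j^{(j)}`, box in `□_{j−1}`) are served.
[cite: Balaban1985RegularSpaces, (1.133) p.99, (1.35) p.82, (1.31) p.82, p.77 («at least one end-point of b belongs to Ω»), (1.66) p.87] -/
theorem h135_cutFixed_γ (L : ℕ) (hL : 2 ≤ L) (hd : 1 ≤ d) {G : Subgroup 𝔸ˣ} (hG : AvgClosed d L G)
    (k : ℕ) (U : Site d → Fin d → 𝔸ˣ) (hU : ∀ x κ, U x κ ∈ G) {α₀ : ℝ} (hα : 0 < α₀)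
    (hα3 : C0 d * (α₀ * (L : ℝ) ^ 2) ≤ 1 / 3) (hα2 : 2 * (α₀ * (L : ℝ) ^ 2) ≤ c2' d L)
    (a : Site d) {M ρ : ℕ} (hρ : 1 ≤ ρ) (hρM : ρ ≤ M) (hM : 11 * (d : ℝ) < M)
    {η : ℝ} {Ω : ℕ → Set (Site d)} (hA : InAk L k η α₀ Ω U) (hT : tcube L a M ρ k ⊆ Ω (k - 1))
    (hsmall : 11 * (d : ℝ) ^ 2 * (L : ℝ) ^ 2 * α₀ + ((M : ℝ) + 4 * ρ) * d * (L : ℝ) ^ 2 * α₀ ≤ 1 / 6) :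
    ∀ j, j ≤ k → ∀ (z : Site d) (μ : Fin d),
      (∀ x, InBox (loK L j z) (bondHiK L j z μ) x → x ∈ cubeFam false L a M ρ k (j - 1)) →
        ‖(avgIter L (mulCfg (cutFixed L (tLo a ρ) (tHi a M ρ) U k (ctr a M)) (1 : Site d → Fin d → 𝔸ˣ)) j z μ : 𝔸) -
            (avgIter L (1 : Site d → Fin d → 𝔸ˣ) j z μ : 𝔸)‖ ≤ 6 * d * (L : ℝ) ^ 2 * M * α₀ :=
  fun j hj z μ hbox => h135_cutFixed_tcube L hL hd hG k U hU hα hα3 hα2 a hρ hρM hM hA hT hsmall j hj z μ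
    (bondBox_subset_tcube_of_subset_cubeFam hL a M hρ (show j - 1 ≤ k by omega) hbox)

end Analytic

/-! ## §3 «The assumptions of Theorem 4 are satisfied for the pair of configurations 1, U₀″» — EDITION γ of the driver's currency -/

section Hypotheses

variable {𝔸 : Type*} [CStarAlgebra 𝔸] [Nontrivial 𝔸]

/-- ★★ **THE p. 99 SENTENCE AT THE CUBE MEMBER IN THE CURRENCY OF THE γ DRIVER** (dag-n05-e `B8Thm4KLevelGamma` ∕ `H42_of_inAx_γ`): the six conjuncts
of `B8Prop6CubeMember.thm4_hypotheses_one_cutFixed` — `U₀″` unitary-valued; (1.33) for `1`; (1.34) = (1.132) `U₀″ ∈ 𝔄_k({□_j}, L³α₀)`; `Ax` at every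
truncation `m ≤ k` w.r.t. `cubeLamS … m`; (1.66) = (1.133) on the level-0 collar — VERBATIM, with the (1.35)∕(1.66) conjunct now in PRINT's guard
«the box of the level-`j` bond lies in `□_{j−1}`» (§2 `h135_cutFixed_γ`) instead of «in `□_j`».  Same binders as the «box ⊂ □_j» edition.
[cite: Balaban1985RegularSpaces, p.99 (sentence after (1.133)), (1.132)–(1.133) p.99, (1.33)–(1.35) p.82, (1.66) p.87, p.77] -/
theorem thm4_hypotheses_one_cutFixed_γ (L : ℕ) (hL : 2 ≤ L) (hd : 1 ≤ d) (k : ℕ)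
    (U : Site d → Fin d → 𝔸ˣ) (hU : ∀ x κ, U x κ ∈ unitaryUnits 𝔸) {α₀ : ℝ} (hα : 0 < α₀)
    (hα3 : C0 d * (α₀ * (L : ℝ) ^ 2) ≤ 1 / 3) (hα2 : 2 * (α₀ * (L : ℝ) ^ 2) ≤ c2' d L)
    (a : Site d) {M ρ : ℕ} (hρ : 1 ≤ ρ) (hρM : ρ ≤ M) (hM : 11 * (d : ℝ) < M)
    {η : ℝ} (hη : 0 < η) {Ω : ℕ → Set (Site d)} (hA : InAk L k η α₀ Ω U) (hT : tcube L a M ρ k ⊆ Ω (k - 1))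
    (hsmall : 11 * (d : ℝ) ^ 2 * (L : ℝ) ^ 2 * α₀ + ((M : ℝ) + 4 * ρ) * d * (L : ℝ) ^ 2 * α₀ ≤ 1 / 6) :
    (∀ x κ, cutFixed L (tLo a ρ) (tHi a M ρ) U k (ctr a M) x κ ∈ unitaryUnits 𝔸) ∧
    InAk L k η ((L : ℝ) ^ 3 * α₀) (cubeFam false L a M ρ k) (1 : Site d → Fin d → 𝔸ˣ) ∧
    InAk L k η ((L : ℝ) ^ 3 * α₀) (cubeFam false L a M ρ k)
      (mulCfg (cutFixed L (tLo a ρ) (tHi a M ρ) U k (ctr a M)) (1 : Site d → Fin d → 𝔸ˣ)) ∧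
    (∀ m, m ≤ k → InAx L m (cubeLamS L a M ρ k m) (1 : Site d → Fin d → 𝔸ˣ)
      (mulCfg (cutFixed L (tLo a ρ) (tHi a M ρ) U k (ctr a M)) (1 : Site d → Fin d → 𝔸ˣ))) ∧
    (∀ j, j ≤ k → ∀ (z : Site d) (μ : Fin d),
      (∀ x, InBox (loK L j z) (bondHiK L j z μ) x → x ∈ cubeFam false L a M ρ k (j - 1)) →
        ‖(avgIter L (mulCfg (cutFixed L (tLo a ρ) (tHi a M ρ) U k (ctr a M)) (1 : Site d → Fin d → 𝔸ˣ)) j z μ : 𝔸) -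
            (avgIter L (1 : Site d → Fin d → 𝔸ˣ) j z μ : 𝔸)‖ ≤ 6 * d * (L : ℝ) ^ 2 * M * α₀) ∧
    (∀ b ∈ {b : Site d × Fin d | SideTouches (cubeFam false L a M ρ k 0) b.1 b.2},
      ‖((cutFixed L (tLo a ρ) (tHi a M ρ) U k (ctr a M) b.1 b.2 : 𝔸ˣ) : 𝔸) - 1‖ ≤ 6 * d * (L : ℝ) ^ 2 * M * α₀) := by
  obtain ⟨hmem, h33, h34, hAx, -, h66⟩ :=
    thm4_hypotheses_one_cutFixed L hL hd k U hU hα hα3 hα2 a hρ hρM hM hη hA hT hsmall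
  exact ⟨hmem, h33, h34, hAx,
    h135_cutFixed_γ L hL hd (avgClosed_unitaryUnits (𝔸 := 𝔸) d L) k U hU hα hα3 hα2 a hρ hρM hM hA hT hsmall, h66⟩

end Hypotheses

end Literature.MathematicalPhysics.QuantumFieldTheory.Balaban1983to89.B8Ineq133CubeMemberGamma
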